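import Summits.Parity.BatemanHorn.Theorems.AlmostPrimeZerosLinearCappedRepulsionTilted

/-!
# Crux `SystemZeroRepulsion` (stmt-Parity-11291), line `smooth-rough-lattice-acquisition` (reshaped,
lead c2): the transfer of the `f = X` tilted majorant through a bounded perturbation (`stub_shiftCore`)

Calibration class `k = 1`, `f = X + h` of the crux, part 1 of 2.  With `s(m) = Σ_{p^v ∥ m} min(v,2)` and
`P_y(z) = Σ_{0 ≤ m ≤ y} z^{s(m)}` (the almost-prime polynomial of `f = X`): if an exponent sequence `s'`
and a reindexing `x ↦ x'` with `|x' − x| ≤ H` satisfy `‖Σ_{n≤x} z^{s'(n)} − P_{x'}(z)‖ ≤ E₀ e^{d(1+‖z−1‖)}`,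
then the landed one-sided tilted majorant of `P_y` (`tiltedMajorant`, crux `LinearCappedRepulsion`)
transfers to `Σ_{n≤x} z^{s'(n)}` on the disc `‖z − 1‖ ≤ log log x / C'` (registered helper stub
`stub_shiftCore`).  Part 2 (`…ShiftTiltedMajorant.lean`) feeds it the shifted statistic `s((n+h)⁺)`.
Everything here is PROVED.
-/

noncomputable section

namespace Summit.Parity.BatemanHorn.Cruxes.SystemZeroRepulsion.NearFar

open scoped BigOperators
open Filter
open Summit.Parity.BatemanHorn.Cruxes.LinearCappedRepulsion.JensenStieltjesMajorant

/-! ### A trivial majorant -/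

/-- The trivial majorant of a sum of powers: if `s(n) ≤ d` on `S` then
`‖Σ_{n ∈ S} z^{s(n)}‖ ≤ #S · exp(d (1 + ‖z − 1‖))`. -/
theorem shift_norm_sum_pow_le {ι : Type*} (S : Finset ι) (s : ι → ℕ) {d : ℝ} (hd0 : 0 ≤ d)
    (hd : ∀ n ∈ S, (s n : ℝ) ≤ d) (z : ℂ) :
    ‖∑ n ∈ S, z ^ (s n)‖ ≤ (S.card : ℝ) * Real.exp (d * (1 + ‖z - 1‖)) := by
  -- adapted from Theorems/AlmostPrimeZerosSystemZeroRepulsionNearZone.lean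
  have hz : ‖z‖ ≤ 1 + ‖z - 1‖ := by
    have h := norm_sub_norm_le z 1
    rw [norm_one] at h
    linarith
  have hterm : ∀ n ∈ S, ‖z ^ (s n)‖ ≤ Real.exp (d * (1 + ‖z - 1‖)) := by
    intro n hn
    rw [norm_pow]
    calc ‖z‖ ^ (s n) ≤ (1 + ‖z - 1‖) ^ (s n) := pow_le_pow_left₀ (norm_nonneg _) hz _
      _ ≤ (Real.exp ‖z - 1‖) ^ (s n) :=
          pow_le_pow_left₀ (by positivity)
            (by have := Real.add_one_le_exp ‖z - 1‖; linarith) _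
      _ = Real.exp ((s n : ℝ) * ‖z - 1‖) := (Real.exp_nat_mul _ _).symm
      _ ≤ Real.exp (d * (1 + ‖z - 1‖)) :=
          Real.exp_le_exp.2 (mul_le_mul (hd n hn) (by linarith) (norm_nonneg _) hd0)
  calc ‖∑ n ∈ S, z ^ (s n)‖ ≤ ∑ n ∈ S, ‖z ^ (s n)‖ := norm_sum_le _ _
    _ ≤ ∑ n ∈ S, Real.exp (d * (1 + ‖z - 1‖)) := Finset.sum_le_sum hterm
    _ = (S.card : ℝ) * Real.exp (d * (1 + ‖z - 1‖)) := by
        rw [Finset.sum_const, nsmul_eq_mul]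

/-! ### Analytic bookkeeping -/

/-- `1 ≤ log log x` for `x ≥ 16`: `log 16 = 4 log 2 > 2.77 > e`. -/
private theorem shift_one_le_loglog {x : ℝ} (hx : 16 ≤ x) : 1 ≤ Real.log (Real.log x) := by
  -- adapted from Theorems/AlmostPrimeZerosSystemZeroRepulsionNearZone.lean
  have h16 : Real.log 16 = 4 * Real.log 2 := by
    rw [show (16 : ℝ) = 2 ^ 4 by norm_num, Real.log_pow]
    norm_num
  have hlog2 := Real.log_two_gt_d9
  have he := Real.exp_one_lt_d9
  have h1 : Real.exp 1 ≤ Real.log x := by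
    have : Real.log 16 ≤ Real.log x := Real.log_le_log (by norm_num) hx
    linarith
  calc (1 : ℝ) = Real.log (Real.exp 1) := (Real.log_exp 1).symm
    _ ≤ Real.log (Real.log x) := Real.log_le_log (Real.exp_pos 1) h1

/-- `log log u − log log v ≤ (u − v)/v` for `3 ≤ v ≤ u` (twice `log t ≤ t − 1`, and `log v ≥ 1`). -/
private theorem shift_loglog_sub_le {u v : ℝ} (hv : 3 ≤ v) (hvu : v ≤ u) :
    Real.log (Real.log u) - Real.log (Real.log v) ≤ (u - v) / v := by
  have hv0 : 0 < v := by linarith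
  have hu0 : 0 < u := by linarith
  have hlog3 : 1 < Real.log 3 := by
    rw [Real.lt_log_iff_exp_lt (by norm_num)]
    have := Real.exp_one_lt_d9
    linarith
  have hlv : 1 < Real.log v := hlog3.trans_le (Real.log_le_log (by norm_num) hv)
  have hlu : 1 < Real.log u := hlv.trans_le (Real.log_le_log hv0 hvu)
  have hlv0 : 0 < Real.log v := by linarith
  have hlu0 : 0 < Real.log u := by linarith
  have h1 : Real.log (Real.log u) - Real.log (Real.log v) = Real.log (Real.log u / Real.log v) := by
    rw [Real.log_div hlu0.ne' hlv0.ne']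
  have h2 : Real.log (Real.log u / Real.log v) ≤ Real.log u / Real.log v - 1 :=
    Real.log_le_sub_one_of_pos (div_pos hlu0 hlv0)
  have h3 : Real.log u / Real.log v - 1 = (Real.log u - Real.log v) / Real.log v := by
    field_simp
  have h4 : Real.log u - Real.log v = Real.log (u / v) := by rw [Real.log_div hu0.ne' hv0.ne']
  have h5 : Real.log (u / v) ≤ u / v - 1 := Real.log_le_sub_one_of_pos (div_pos hu0 hv0)
  have h6 : u / v - 1 = (u - v) / v := by field_simp
  have h7 : 0 ≤ Real.log (u / v) := Real.log_nonneg ((one_le_div hv0).2 hvu)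
  have h8 : (Real.log u - Real.log v) / Real.log v ≤ Real.log u - Real.log v := by
    rw [h4]
    exact div_le_self h7 hlv.le
  calc Real.log (Real.log u) - Real.log (Real.log v)
      = Real.log (Real.log u / Real.log v) := h1
    _ ≤ (Real.log u - Real.log v) / Real.log v := by rw [← h3]; exact h2
    _ ≤ Real.log u - Real.log v := h8
    _ = Real.log (u / v) := h4
    _ ≤ (u - v) / v := by rw [← h6]; exact h5

/-- `|log log u − log log v| ≤ H/(w − H)` when `u, v ≥ w − H ≥ 3` and `|u − v| ≤ H` (in the form used
below: `u, v ∈ [w − H, w + H]` with one of them equal to `w`... we only need both in `[w−H, w+H]`). -/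
private theorem shift_abs_loglog_sub_le {u v w H : ℝ} (hH : 0 ≤ H) (hw : 3 ≤ w - H)
    (hu1 : w - H ≤ u) (hv1 : w - H ≤ v) (huv : |u - v| ≤ H) :
    |Real.log (Real.log u) - Real.log (Real.log v)| ≤ H / (w - H) := by
  have hwH : 0 < w - H := by linarith
  rcases le_total v u with h | h
  · rw [abs_of_nonneg]
    · calc Real.log (Real.log u) - Real.log (Real.log v) ≤ (u - v) / v :=
            shift_loglog_sub_le (by linarith) h
        _ ≤ H / (w - H) := by
            rw [div_le_div_iff₀ (by linarith) hwH]
            have h1 : u - v ≤ H := (le_abs_self _).trans huv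
            nlinarith
    · have := shift_loglog_sub_le (u := u) (v := v) (by linarith) h
      -- monotonicity: `log log v ≤ log log u`
      have hv0 : 0 < v := by linarith
      have hlv : 0 < Real.log v := Real.log_pos (by linarith)
      linarith [Real.log_le_log hlv (Real.log_le_log hv0 h)]
  · rw [abs_sub_comm, abs_of_nonneg]
    · calc Real.log (Real.log v) - Real.log (Real.log u) ≤ (v - u) / u :=
            shift_loglog_sub_le (by linarith) h
        _ ≤ H / (w - H) := by
            rw [div_le_div_iff₀ (by linarith) hwH]
            have h1 : v - u ≤ H := by
              have := neg_abs_le (u - v); have := huv; linarith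
            nlinarith
    · have hu0 : 0 < u := by linarith
      have hlu : 0 < Real.log u := Real.log_pos (by linarith)
      linarith [Real.log_le_log hlu (Real.log_le_log hu0 h)]

/-- For constants `a, b, c`: eventually in `x : ℕ`,
`a (log log x)² + b log log x + c ≤ log x` (each term is `o(log x)`). -/
private theorem shift_eventually_quad_loglog_le_log (a b c : ℝ) :
    ∀ᶠ x : ℕ in atTop, a * Real.log (Real.log x) ^ 2 + b * Real.log (Real.log x) + c ≤ Real.log x := by
  have h1 : (fun u : ℝ => Real.log u ^ 2) =o[atTop] id := Real.isLittleO_pow_log_id_atTop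
  have h2 : (fun u : ℝ => Real.log u ^ 1) =o[atTop] id := Real.isLittleO_pow_log_id_atTop
  have h3 : (fun _ : ℝ => c) =o[atTop] id := Asymptotics.isLittleO_const_id_atTop c
  have h : (fun u : ℝ => a * Real.log u ^ 2 + b * Real.log u + c) =o[atTop] id := by
    have := ((h1.const_mul_left a).add (h2.const_mul_left b)).add h3
    simpa [pow_one] using this
  have hev : ∀ᶠ u : ℝ in atTop, a * Real.log u ^ 2 + b * Real.log u + c ≤ u := by
    filter_upwards [h.def zero_lt_one, eventually_ge_atTop (0 : ℝ)] with u hu hu0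
    rw [one_mul, id, Real.norm_eq_abs, Real.norm_eq_abs, abs_of_nonneg hu0] at hu
    exact (le_abs_self _).trans hu
  exact (Real.tendsto_log_atTop.comp tendsto_natCast_atTop_atTop).eventually hev

/-! ### The core: transfer of the tilted majorant through a bounded perturbation -/

/-- **Transfer of `tiltedMajorant` to a perturbed family.**  Let `s' : ℕ → ℕ` be an exponent sequence
and `x ↦ x'` a reindexing with `x − H ≤ x' ≤ x + H`, such that for all `x`, `z`:
`‖Σ_{n≤x} z^{s'(n)} − P_{x'}(z)‖ ≤ E₀ e^{d(1+‖z−1‖)}` (`E₀ ≥ H + 1`, `d ≥ 0`), where `P_y(z) = Σ_{m≤y} z^{s(m)}` (registered helper stub `stub_shiftCore`).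
Then `Σ_{n≤x} z^{s'(n)}` obeys the one-sided tilted majorant
`‖Σ z^{s'(n)}‖ ≤ (x+1)exp(log log x (Re z − 1) + A'(1+‖z−1‖)^{3/2})` on `‖z−1‖ ≤ log log x/C'`, `x ≥ X`,
with `C' = 2 max C 1`, `A' = A + log(2E₀) + 1` (`A, C` from `tiltedMajorant`).  Bookkeeping (`L = log log x`,
`L' = log log x'`, `r = ‖z−1‖ ≤ L/C' ≤ L/2`): `|L' − L| ≤ H/(x−H)`, so `|L'−L|·r ≤ 1` and `L ≤ 2L'` once
`H·L + 2H + 16 ≤ x` (giving the disc inclusion `L/C' ≤ L'/C` and `L'(Re z−1) ≤ L(Re z−1) + 1`); the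
perturbation is `≤ (x+1)e^{−L r} ≤ (x+1)e^{L(Re z−1)}` once `L²/2 + (d/2)L + d + log E₀ ≤ log x`. -/
theorem stub_shiftCore :
    ∀ (s' : ℕ → ℕ) (x' : ℕ → ℕ) (H : ℕ) (E₀ d : ℝ), (H : ℝ) + 1 ≤ E₀ → 0 ≤ d →
      (∀ x, x ≤ x' x + H) → (∀ x, x' x ≤ x + H) →
      (∀ (x : ℕ) (z : ℂ), ‖(∑ n ∈ Finset.range (x + 1), z ^ (s' n)) -
        ∑ m ∈ Finset.range (x' x + 1), z ^ (m.factorization.sum fun _ v => min v 2)‖ ≤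
          E₀ * Real.exp (d * (1 + ‖z - 1‖))) →
      ∃ A : ℝ, 0 ≤ A ∧ ∃ C : ℝ, 0 < C ∧ ∃ x₀ : ℕ, ∀ x : ℕ, x₀ ≤ x → ∀ z : ℂ,
        ‖z - 1‖ ≤ Real.log (Real.log x) / C →
        ‖∑ n ∈ Finset.range (x + 1), z ^ (s' n)‖ ≤
          ((x : ℝ) + 1) * Real.exp (Real.log (Real.log x) * (z.re - 1) + A * (1 + ‖z - 1‖) ^ (3 / 2 : ℝ)) := by
  intro s' x' H E₀ d hE₀ hd hx'l hx'u hpert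
  obtain ⟨A, hA0, C, hC, x₀, hmaj⟩ := tiltedMajorant
  have hH0 : (0 : ℝ) ≤ H := Nat.cast_nonneg H
  have hE₁ : 1 ≤ E₀ := by linarith
  have hE0 : 0 < E₀ := by linarith
  -- constants
  set C' : ℝ := 2 * max C 1 with hC'def
  have hC'2 : 2 ≤ C' := by have := le_max_right C 1; rw [hC'def]; linarith
  have hC'C : 2 * C ≤ C' := by have := le_max_left C 1; rw [hC'def]; linarith
  have hC' : 0 < C' := by linarith
  have hlog2E : 0 ≤ Real.log (2 * E₀) := Real.log_nonneg (by linarith)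
  set A' : ℝ := A + Real.log (2 * E₀) + 1 with hA'def
  have hA'0 : 0 ≤ A' := by rw [hA'def]; linarith
  -- threshold
  have hev : ∀ᶠ x : ℕ in atTop, ((x₀ : ℝ) + H + 16 ≤ x) ∧
      ((H : ℝ) * Real.log (Real.log x) + 2 * H + 16 ≤ x) ∧
      (Real.log (Real.log x) ^ 2 / 2 + d / 2 * Real.log (Real.log x) + (d + Real.log E₀) ≤ Real.log x) := by
    have hA := (tendsto_natCast_atTop_atTop (R := ℝ)).eventually
      (eventually_ge_atTop ((x₀ : ℝ) + H + 16))
    have hB : ∀ᶠ x : ℕ in atTop, (H : ℝ) * Real.log (Real.log x) + 2 * H + 16 ≤ x := by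
      have h1 := shift_eventually_quad_loglog_le_log 0 H (2 * H + 16)
      filter_upwards [h1, eventually_ge_atTop 1] with x hx hx1
      have hx0 : (0 : ℝ) < x := by exact_mod_cast Nat.lt_of_lt_of_le Nat.zero_lt_one hx1
      have hlogle : Real.log (x : ℝ) ≤ x := (Real.log_le_sub_one_of_pos hx0).trans (by linarith)
      linarith
    have hC : ∀ᶠ x : ℕ in atTop, Real.log (Real.log x) ^ 2 / 2 + d / 2 * Real.log (Real.log x) +
        (d + Real.log E₀) ≤ Real.log x := by
      have h1 := shift_eventually_quad_loglog_le_log (1 / 2) (d / 2) (d + Real.log E₀)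
      filter_upwards [h1] with x hx
      linarith
    exact hA.and (hB.and hC)
  obtain ⟨X, hX⟩ := eventually_atTop.1 hev
  refine ⟨A', hA'0, C', hC', X, fun x hx z hz => ?_⟩
  obtain ⟨hx1, hx2, hx3⟩ := hX x hx
  -- basic quantities
  set L : ℝ := Real.log (Real.log (x : ℝ)) with hLdef
  set L' : ℝ := Real.log (Real.log (x' x : ℝ)) with hL'def
  set r : ℝ := ‖z - 1‖ with hrdef
  have hr0 : 0 ≤ r := norm_nonneg _
  have hx16 : (16 : ℝ) ≤ x := by linarith [hH0, (Nat.cast_nonneg x₀ : (0 : ℝ) ≤ x₀)]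
  have hL1 : 1 ≤ L := shift_one_le_loglog hx16
  have hL0 : 0 ≤ L := by linarith
  have hxl : (x : ℝ) ≤ (x' x : ℝ) + H := by exact_mod_cast hx'l x
  have hxu : (x' x : ℝ) ≤ (x : ℝ) + H := by exact_mod_cast hx'u x
  have hx'16 : (16 : ℝ) ≤ x' x := by linarith
  have hL'1 : 1 ≤ L' := shift_one_le_loglog hx'16
  have hx₀' : x₀ ≤ x' x := by
    have : (x₀ : ℝ) ≤ x' x := by linarith
    exact_mod_cast this
  -- `r ≤ L / C' ≤ L / 2`
  have hrL : r ≤ L / C' := hz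
  have hrL2 : r ≤ L / 2 := hrL.trans (div_le_div_of_nonneg_left hL0 (by norm_num) hC'2)
  -- `|L' - L| ≤ H / (x - H)` and `|L' - L| * r ≤ 1`
  have hHL : 0 ≤ (H : ℝ) * L := mul_nonneg hH0 hL0
  have hxH3 : (3 : ℝ) ≤ (x : ℝ) - H := by linarith
  have hδ : |L' - L| ≤ (H : ℝ) / ((x : ℝ) - H) := by
    refine shift_abs_loglog_sub_le hH0 hxH3 (by linarith) (by linarith) ?_
    rw [abs_le]; constructor <;> linarith
  have hxHpos : (0 : ℝ) < (x : ℝ) - H := by linarith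
  have hδ1 : |L' - L| ≤ 1 := hδ.trans (by rw [div_le_one hxHpos]; linarith)
  have hδr : |L' - L| * r ≤ 1 := by
    have h1 : |L' - L| * r ≤ (H : ℝ) / ((x : ℝ) - H) * (L / 2) :=
      mul_le_mul hδ hrL2 hr0 (div_nonneg hH0 hxHpos.le)
    have h2 : (H : ℝ) / ((x : ℝ) - H) * (L / 2) ≤ 1 := by
      rw [div_mul_div_comm, div_le_one (by positivity)]
      linarith
    exact h1.trans h2
  -- disc inclusion `r ≤ L' / C`
  have hLL' : L ≤ 2 * L' := by
    have : L - L' ≤ 1 := by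
      have := neg_abs_le (L' - L); linarith [hδ1]
    linarith
  have hrC : r ≤ L' / C := by
    refine hrL.trans ?_
    rw [div_le_div_iff₀ hC' hC]
    calc L * C ≤ 2 * L' * C := mul_le_mul_of_nonneg_right hLL' hC.le
      _ = L' * (2 * C) := by ring
      _ ≤ L' * C' := mul_le_mul_of_nonneg_left hC'C (by linarith)
  -- the landed majorant at `x'`
  have hmain := hmaj (x' x) hx₀' z (by rw [← hL'def, ← hrdef]; exact hrC)
  rw [← hL'def, ← hrdef] at hmain
  -- (iii) `L' (Re z - 1) ≤ L (Re z - 1) + 1`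
  have hσ : |z.re - 1| ≤ r := by
    have h := Complex.abs_re_le_norm (z - 1)
    simpa [hrdef] using h
  have hiii : L' * (z.re - 1) ≤ L * (z.re - 1) + 1 := by
    have h1 : (L' - L) * (z.re - 1) ≤ |L' - L| * r := by
      calc (L' - L) * (z.re - 1) ≤ |(L' - L) * (z.re - 1)| := le_abs_self _
        _ = |L' - L| * |z.re - 1| := abs_mul _ _
        _ ≤ |L' - L| * r := mul_le_mul_of_nonneg_left hσ (abs_nonneg _)
    linarith
  -- (v) the perturbation is `≤ (x + 1) exp (L (Re z - 1))`
  have hLσ : -(L ^ 2 / 2) ≤ L * (z.re - 1) := by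
    have h1 : -r ≤ z.re - 1 := by have := neg_abs_le (z.re - 1); linarith [hσ]
    have h2 : L * (-r) ≤ L * (z.re - 1) := mul_le_mul_of_nonneg_left h1 hL0
    have h3 : L * r ≤ L * (L / 2) := mul_le_mul_of_nonneg_left hrL2 hL0
    have h4 : L * (L / 2) = L ^ 2 / 2 := by ring
    linarith
  have hx0 : (0 : ℝ) < x := by linarith
  have hpert' : E₀ * Real.exp (d * (1 + r)) ≤ ((x : ℝ) + 1) * Real.exp (L * (z.re - 1)) := by
    have h1 : E₀ * Real.exp (d * (1 + r)) = Real.exp (Real.log E₀ + d * (1 + r)) := by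
      rw [Real.exp_add, Real.exp_log hE0]
    have h2 : Real.log E₀ + d * (1 + r) ≤ Real.log x - L ^ 2 / 2 := by
      have h21 : d * r ≤ d * (L / 2) := mul_le_mul_of_nonneg_left hrL2 hd
      have h22 : d * (1 + r) = d + d * r := by ring
      have h23 : d * (L / 2) = d / 2 * L := by ring
      linarith
    have h3 : Real.exp (Real.log x - L ^ 2 / 2) = (x : ℝ) * Real.exp (-(L ^ 2 / 2)) := by
      rw [sub_eq_add_neg, Real.exp_add, Real.exp_log hx0]
    calc E₀ * Real.exp (d * (1 + r)) = Real.exp (Real.log E₀ + d * (1 + r)) := h1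
      _ ≤ Real.exp (Real.log x - L ^ 2 / 2) := Real.exp_le_exp.2 h2
      _ = (x : ℝ) * Real.exp (-(L ^ 2 / 2)) := h3
      _ ≤ ((x : ℝ) + 1) * Real.exp (L * (z.re - 1)) :=
          mul_le_mul (by linarith) (Real.exp_le_exp.2 hLσ) (Real.exp_pos _).le (by linarith)
  -- the main term
  set q : ℝ := (1 + r) ^ (3 / 2 : ℝ) with hqdef
  have hq1 : 1 ≤ q := Real.one_le_rpow (by linarith) (by norm_num)
  have hmain' : ((x' x : ℝ) + 1) * Real.exp (L' * (z.re - 1) + A * q) ≤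
      E₀ * ((x : ℝ) + 1) * Real.exp (L * (z.re - 1)) * Real.exp (1 + A * q) := by
    have h1 : ((x' x : ℝ) + 1) ≤ E₀ * ((x : ℝ) + 1) := by
      have hHx : 0 ≤ (H : ℝ) * x := by positivity
      have h11 : ((x' x : ℝ) + 1) ≤ ((H : ℝ) + 1) * ((x : ℝ) + 1) := by nlinarith
      exact h11.trans (mul_le_mul_of_nonneg_right hE₀ (by positivity))
    have h2 : Real.exp (L' * (z.re - 1) + A * q) ≤ Real.exp (L * (z.re - 1)) * Real.exp (1 + A * q) := by
      rw [← Real.exp_add]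
      refine Real.exp_le_exp.2 ?_
      have h21 : L' * (z.re - 1) + A * q ≤ (L * (z.re - 1) + 1) + A * q := add_le_add hiii le_rfl
      have h22 : (L * (z.re - 1) + 1) + A * q = L * (z.re - 1) + (1 + A * q) := by ring
      rw [← h22]; exact h21
    calc ((x' x : ℝ) + 1) * Real.exp (L' * (z.re - 1) + A * q)
        ≤ (E₀ * ((x : ℝ) + 1)) * (Real.exp (L * (z.re - 1)) * Real.exp (1 + A * q)) :=
          mul_le_mul h1 h2 (Real.exp_pos _).le (by positivity)
      _ = _ := by ring
  -- combine
  have hsum : ‖∑ n ∈ Finset.range (x + 1), z ^ (s' n)‖ ≤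
      ((x : ℝ) + 1) * Real.exp (L * (z.re - 1)) * (E₀ * Real.exp (1 + A * q) + 1) := by
    have htri : ‖∑ n ∈ Finset.range (x + 1), z ^ (s' n)‖ ≤
        ‖∑ m ∈ Finset.range (x' x + 1), z ^ (m.factorization.sum fun _ v => min v 2)‖ +
          ‖(∑ n ∈ Finset.range (x + 1), z ^ (s' n)) -
            ∑ m ∈ Finset.range (x' x + 1), z ^ (m.factorization.sum fun _ v => min v 2)‖ := by
      have := norm_add_le (∑ m ∈ Finset.range (x' x + 1), z ^ (m.factorization.sum fun _ v => min v 2))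
        ((∑ n ∈ Finset.range (x + 1), z ^ (s' n)) -
          ∑ m ∈ Finset.range (x' x + 1), z ^ (m.factorization.sum fun _ v => min v 2))
      rwa [add_sub_cancel] at this
    have hP := hmain.trans hmain'
    have hE : ‖(∑ n ∈ Finset.range (x + 1), z ^ (s' n)) -
        ∑ m ∈ Finset.range (x' x + 1), z ^ (m.factorization.sum fun _ v => min v 2)‖ ≤
          ((x : ℝ) + 1) * Real.exp (L * (z.re - 1)) := by
      refine (hpert x z).trans ?_
      rw [← hrdef]
      exact hpert'
    calc ‖∑ n ∈ Finset.range (x + 1), z ^ (s' n)‖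
        ≤ E₀ * ((x : ℝ) + 1) * Real.exp (L * (z.re - 1)) * Real.exp (1 + A * q) +
            ((x : ℝ) + 1) * Real.exp (L * (z.re - 1)) := htri.trans (add_le_add hP hE)
      _ = ((x : ℝ) + 1) * Real.exp (L * (z.re - 1)) * (E₀ * Real.exp (1 + A * q) + 1) := by ring
  -- `E₀ e^{1 + A q} + 1 ≤ exp((log(2E₀) + 1 + A) q)` hence the `A'`-form
  have hfin : E₀ * Real.exp (1 + A * q) + 1 ≤ Real.exp ((Real.log (2 * E₀) + 1) * q + A * q) := by
    have h1 : E₀ * Real.exp (1 + A * q) + 1 ≤ 2 * E₀ * Real.exp (1 + A * q) := by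
      have : 1 ≤ E₀ * Real.exp (1 + A * q) :=
        one_le_mul_of_one_le_of_one_le hE₁ (Real.one_le_exp (by positivity))
      linarith
    have h2 : Real.exp (Real.log (2 * E₀) + 1 + A * q) = 2 * E₀ * Real.exp (1 + A * q) := by
      rw [add_assoc, Real.exp_add, Real.exp_log (by linarith)]
    have h3 : Real.log (2 * E₀) + 1 + A * q ≤ (Real.log (2 * E₀) + 1) * q + A * q := by
      have h31 : (Real.log (2 * E₀) + 1) * 1 ≤ (Real.log (2 * E₀) + 1) * q :=
        mul_le_mul_of_nonneg_left hq1 (by linarith)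
      linarith
    rw [← h2] at h1
    exact h1.trans (Real.exp_le_exp.2 h3)
  have hexpeq : Real.exp (L * (z.re - 1)) * Real.exp ((Real.log (2 * E₀) + 1) * q + A * q) =
      Real.exp (L * (z.re - 1) + A' * q) := by
    rw [← Real.exp_add]
    congr 1
    rw [hA'def]
    ring
  calc ‖∑ n ∈ Finset.range (x + 1), z ^ (s' n)‖
      ≤ ((x : ℝ) + 1) * Real.exp (L * (z.re - 1)) * (E₀ * Real.exp (1 + A * q) + 1) := hsum
    _ ≤ ((x : ℝ) + 1) * Real.exp (L * (z.re - 1)) * Real.exp ((Real.log (2 * E₀) + 1) * q + A * q) :=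
        mul_le_mul_of_nonneg_left hfin (by positivity)
    _ = ((x : ℝ) + 1) * Real.exp (L * (z.re - 1) + A' * q) := by
        rw [mul_assoc, hexpeq]

end Summit.Parity.BatemanHorn.Cruxes.SystemZeroRepulsion.NearFar

end
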